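import Mathlib
import HarnessLib

/-!
# Route `UnthreadedDoor`, crux `PoloidalLiouville` (stmt-NavierStokesRegularity-1222), wall W1 — crux idea
# «flux-starved-dipoles»: one-variable tools for the latitude Fourier modes (L0 `SphereTangentUnthreadedVanishes`)

Pure one-variable calculus used by `…FluxStarvedDipoleLatitudeModes` (all latitude Fourier modes of a tangent, solenoidal,
unthreaded field vanish):

* `hasDerivAt_intervalIntegral_of_continuous` — differentiation under `∫₀^{2π}` for jointly continuous `F, ∂_θF` (the dominated
  convergence bookkeeping of p838833/p838877, packaged);
* `hasDerivAt_cos_mul`, `hasDerivAt_sin_mul`, `integral_cos_mul_deriv_periodic`, `integral_sin_mul_deriv_periodic` — periodic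
  integration by parts on `[0, 2π]` against `cos kφ`, `sin kφ` (`k ∈ ℕ`);
* `deriv_eq_zero_of_monotone_pinned` — a function with derivative `≥ 0` on `(0, π)` and values `0` at `0` and `π` has zero
  derivative on `(0, π)`.

HONEST LABEL: calculus tooling (information-grade for W1, movement 0); `PoloidalLiouville` (1222), its wall `stub_scalarLiouville` and
the summit stay OPEN; NO Navier–Stokes regularity statement is proved.  `--supports stmt-NavierStokesRegularity-1222` (helper).
[folklore]
-/

noncomputable section

-- the summit and its single sub-problem share the name (CONVENTIONS §1)
set_option linter.dupNamespace false

open Set Filter Topology MeasureTheory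

namespace Summit.NavierStokesRegularity.NavierStokesRegularity.Theorems.PoloidalLiouville.FluxStarvedDipole

/-! ### One-variable tools -/

/-- **Differentiation under `∫₀^{2π}` for jointly continuous data**: if `F, F' : ℝ → ℝ → ℝ` are jointly continuous and
`∂_θ F(θ, φ) = F'(θ, φ)` everywhere, then `θ ↦ ∫₀^{2π} F(θ,φ) dφ` has derivative `∫₀^{2π} F'(θ,φ) dφ`. [folklore] -/
theorem hasDerivAt_intervalIntegral_of_continuous {F F' : ℝ → ℝ → ℝ} (hF : Continuous (Function.uncurry F))
    (hF' : Continuous (Function.uncurry F')) (hd : ∀ θ φ, HasDerivAt (fun θ => F θ φ) (F' θ φ) θ) (θ₀ : ℝ) :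
    HasDerivAt (fun θ => ∫ φ in (0 : ℝ)..2 * Real.pi, F θ φ) (∫ φ in (0 : ℝ)..2 * Real.pi, F' θ₀ φ) θ₀ := by
  have hsec : ∀ θ : ℝ, Continuous fun φ : ℝ => (θ, φ) := fun θ => continuous_const.prodMk continuous_id
  have hK : IsCompact (Icc (θ₀ - 1) (θ₀ + 1) ×ˢ Icc (-(2 * Real.pi)) (2 * Real.pi)) := isCompact_Icc.prod isCompact_Icc
  obtain ⟨M, hM⟩ := hK.exists_bound_of_continuousOn hF'.continuousOn
  have hpi : 0 ≤ 2 * Real.pi := by positivity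
  have h := intervalIntegral.hasDerivAt_integral_of_dominated_loc_of_deriv_le (μ := volume)
    (F := F) (F' := F') (x₀ := θ₀) (a := 0) (b := 2 * Real.pi) (bound := fun _ => M) (s := Icc (θ₀ - 1) (θ₀ + 1))
    (Icc_mem_nhds (by linarith) (by linarith))
    (Eventually.of_forall fun θ => (hF.comp (hsec θ)).aestronglyMeasurable)
    ((hF.comp (hsec θ₀)).intervalIntegrable 0 (2 * Real.pi))
    ((hF'.comp (hsec θ₀)).aestronglyMeasurable)
    (Eventually.of_forall fun φ hφ θ hθ => by
      rw [Set.uIoc_of_le hpi] at hφ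
      exact hM (θ, φ) ⟨hθ, ⟨by linarith [hφ.1], hφ.2⟩⟩)
    intervalIntegrable_const
    (Eventually.of_forall fun φ _ θ _ => hd θ φ)
  exact h.2

/-- Derivative of `φ ↦ cos(kφ)`. [folklore] -/
theorem hasDerivAt_cos_mul (k φ : ℝ) : HasDerivAt (fun φ : ℝ => Real.cos (k * φ)) (-(k * Real.sin (k * φ))) φ := by
  have h := (Real.hasDerivAt_cos (k * φ)).comp φ ((hasDerivAt_id φ).const_mul k)
  refine h.congr_deriv ?_
  simp only [mul_one]
  ring

/-- Derivative of `φ ↦ sin(kφ)`. [folklore] -/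
theorem hasDerivAt_sin_mul (k φ : ℝ) : HasDerivAt (fun φ : ℝ => Real.sin (k * φ)) (k * Real.cos (k * φ)) φ := by
  have h := (Real.hasDerivAt_sin (k * φ)).comp φ ((hasDerivAt_id φ).const_mul k)
  refine h.congr_deriv ?_
  simp only [mul_one]
  ring

/-- **Periodic integration by parts against `cos kφ`** (`k ∈ ℕ`): for `g ∈ C¹` with `g(2π) = g(0)`,
`∫₀^{2π} cos(kφ)·g′(φ) dφ = k ∫₀^{2π} sin(kφ)·g(φ) dφ`. [folklore] -/
theorem integral_cos_mul_deriv_periodic {g g' : ℝ → ℝ} (hg : ∀ φ, HasDerivAt g (g' φ) φ) (hg' : Continuous g')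
    (hper : g (2 * Real.pi) = g 0) (k : ℕ) :
    ∫ φ in (0 : ℝ)..2 * Real.pi, Real.cos (k * φ) * g' φ = k * ∫ φ in (0 : ℝ)..2 * Real.pi, Real.sin (k * φ) * g φ := by
  have h := intervalIntegral.integral_mul_deriv_eq_deriv_mul (a := 0) (b := 2 * Real.pi)
    (u := fun φ => Real.cos (k * φ)) (u' := fun φ => -(k * Real.sin (k * φ))) (v := g) (v' := g')
    (fun φ _ => hasDerivAt_cos_mul k φ) (fun φ _ => hg φ)
    ((by fun_prop : Continuous fun φ : ℝ => -((k : ℝ) * Real.sin (k * φ))).intervalIntegrable _ _)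
    (hg'.intervalIntegrable _ _)
  rw [h, hper, mul_zero, Real.cos_zero, Real.cos_nat_mul_two_pi, ← intervalIntegral.integral_const_mul]
  have : ∫ φ in (0 : ℝ)..2 * Real.pi, -(↑k * Real.sin (↑k * φ)) * g φ
      = -∫ φ in (0 : ℝ)..2 * Real.pi, ↑k * (Real.sin (↑k * φ) * g φ) := by
    rw [← intervalIntegral.integral_neg]
    congr 1
    funext φ
    ring
  rw [this]
  ring

/-- **Periodic integration by parts against `sin kφ`** (`k ∈ ℕ`): for `g ∈ C¹` with `g(2π) = g(0)`,
`∫₀^{2π} sin(kφ)·g′(φ) dφ = −k ∫₀^{2π} cos(kφ)·g(φ) dφ`. [folklore] -/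
theorem integral_sin_mul_deriv_periodic {g g' : ℝ → ℝ} (hg : ∀ φ, HasDerivAt g (g' φ) φ) (hg' : Continuous g')
    (hper : g (2 * Real.pi) = g 0) (k : ℕ) :
    ∫ φ in (0 : ℝ)..2 * Real.pi, Real.sin (k * φ) * g' φ = -(k * ∫ φ in (0 : ℝ)..2 * Real.pi, Real.cos (k * φ) * g φ) := by
  have h := intervalIntegral.integral_mul_deriv_eq_deriv_mul (a := 0) (b := 2 * Real.pi)
    (u := fun φ => Real.sin (k * φ)) (u' := fun φ => k * Real.cos (k * φ)) (v := g) (v' := g')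
    (fun φ _ => hasDerivAt_sin_mul k φ) (fun φ _ => hg φ)
    ((by fun_prop : Continuous fun φ : ℝ => (k : ℝ) * Real.cos (k * φ)).intervalIntegrable _ _)
    (hg'.intervalIntegrable _ _)
  have hsin : Real.sin (↑k * (2 * Real.pi)) = 0 := by
    rw [show (k : ℝ) * (2 * Real.pi) = ((2 * k : ℕ) : ℝ) * Real.pi by push_cast; ring]
    exact Real.sin_nat_mul_pi _
  rw [h, hper, mul_zero, Real.sin_zero, hsin, ← intervalIntegral.integral_const_mul]
  have : ∫ φ in (0 : ℝ)..2 * Real.pi, ↑k * Real.cos (↑k * φ) * g φ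
      = ∫ φ in (0 : ℝ)..2 * Real.pi, ↑k * (Real.cos (↑k * φ) * g φ) := by
    congr 1
    funext φ
    ring
  rw [this]
  ring

/-- **Pinned monotone functions are flat**: if `Z` has derivative `Z′ ≥ 0` on `(0, π)` (and some derivative everywhere) with
`Z(0) = Z(π) = 0`, then `Z′ = 0` on `(0, π)`. [folklore] -/
theorem deriv_eq_zero_of_monotone_pinned {Z Z' : ℝ → ℝ} (hZ : ∀ θ, HasDerivAt Z (Z' θ) θ)
    (hnn : ∀ θ ∈ Ioo 0 Real.pi, 0 ≤ Z' θ) (h0 : Z 0 = 0) (hπ : Z Real.pi = 0) :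
    ∀ θ ∈ Ioo 0 Real.pi, Z' θ = 0 := by
  have hmono : MonotoneOn Z (Icc 0 Real.pi) := by
    refine monotoneOn_of_deriv_nonneg (convex_Icc 0 Real.pi) (fun θ _ => (hZ θ).continuousAt.continuousWithinAt)
      (fun θ _ => (hZ θ).differentiableAt.differentiableWithinAt) ?_
    intro θ hθ
    rw [interior_Icc] at hθ
    rw [(hZ θ).deriv]
    exact hnn θ hθ
  have hzero : ∀ θ ∈ Ioo 0 Real.pi, Z θ = 0 := by
    intro θ hθ
    have h1 : Z 0 ≤ Z θ := hmono ⟨le_refl _, Real.pi_pos.le⟩ ⟨hθ.1.le, hθ.2.le⟩ hθ.1.le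
    have h2 : Z θ ≤ Z Real.pi := hmono ⟨hθ.1.le, hθ.2.le⟩ ⟨Real.pi_pos.le, le_refl _⟩ hθ.2.le
    linarith
  intro θ hθ
  have hev : Z =ᶠ[𝓝 θ] fun _ => (0 : ℝ) := by
    filter_upwards [isOpen_Ioo.mem_nhds hθ] with θ' hθ'
    exact hzero θ' hθ'
  rw [← (hZ θ).deriv, hev.deriv_eq, deriv_const]

end Summit.NavierStokesRegularity.NavierStokesRegularity.Theorems.PoloidalLiouville.FluxStarvedDipole

end
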